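import Literature.Dynamics.Homogeneous.OrthogonalGroupOrbitClosuresSubalgebras
import HarnessLib

/-!
# `𝔰𝔬(V₁^⊥)` is generated by nilpotent (unipotent) elements; its fixed vectors and centralizer
# (Verbitsky's erratum, §2.2: "the group `H = SO⁺(a−2,b)` is generated by unipotents")

Topic `Literature/Dynamics/Homogeneous`; theorems only (no new notion, no named fact — D-0026), on
top of `OrthogonalGroupOrbitClosuresSubalgebras` (the wedge calculus `u ∧ w` and the erratum §2.1
classification of the Lie subalgebras `𝔰𝔬(V₀) ⊆ 𝔤 ⊆ 𝔰𝔬(V)`). This file PROVES the second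
algebraic input of the Ratner-theoretic proof of the orbit-closure trichotomy
`Literature.Dynamics.Homogeneous.Verbitsky2017_orbitClosure_trichotomy_K3` (a named fact; elementary
half and the one-hypothesis reduction `…_of_frameOrbitClosure` in `OrthogonalGroupOrbitClosuresProofs`):
the hypothesis under which M. Verbitsky invokes Ratner's orbit-closure theorem
[Verbitsky2017ErgodicErratum, §2.2, Theorem and its proof: "to apply it, we have to check that the
group `H` is generated by unipotents … the group `H = SO⁺(a−2,b)` is simple, and its subgroup
generated by unipotents is normal, hence it is equal to `H`"], in its Lie-algebra / polynomial form,
which is also the form in which Borel's density theorem [Morris2005Ratner, Prop. 4.7.1: the Zariski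
closure of a lattice contains every unipotent element] is applied in §2.3 to exclude the
intermediate groups `SO(V₀)` and `SO(V₀)·SO(V₁)` for irrational planes.

**Setting** (as in `…Subalgebras`): `B` a non-degenerate symmetric bilinear form on a
finite-dimensional `V` over a field `𝕜` of characteristic `≠ 2`; `V₁ ⊆ V` an ANISOTROPIC plane
(`finrank V₁ = 2`, `B(v,v) = 0 ⇒ v = 0` on `V₁`); `dim V ≥ 5`; `V₀ = V₁^⊥ = B.orthogonal V₁`;
`𝔰𝔬(V₀) ⊆ 𝔰𝔬(V) = skewAdjointLieSubalgebra B` the skew endomorphisms killing `V₁`; and — the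
one extra hypothesis of this file — `V₀` ISOTROPIC: it contains a non-zero `u` with `B(u,u) = 0`
(over `ℝ`: `V₀` indefinite; for `V = Λ_{K3} ⊗ ℝ ≅ ℝ^{3,19}` and `V₁` a positive plane,
`V₀ ≅ ℝ^{1,19}`). Without it the results fail (`𝔰𝔬(n)` compact has no nilpotents).

**Results.**
* `SkewPlane.bwedge_pow_three_of_isotropic`: an ISOTROPIC WEDGE `N = u ∧ w` (`u, w ∈ V₀`,
  `B(u,u) = B(u,w) = 0`) has `N³ = 0`; so `u(t) = 1 + tN + ½t²N²` (`= exp(tN)`) is a one-parameter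
  group (`SkewPlane.unipotent_mul_unipotent`) of unipotent (`SkewPlane.unipotent_sub_one_pow_three`)
  `B`-isometries (`SkewPlane.B_unipotent_apply`) fixing `ker N ⊇ V₁`; its fixed vectors are `ker N`
  (`SkewPlane.unipotent_apply_eq_self_iff`) and its centralizer is that of `N`
  (`SkewPlane.commute_unipotent_iff`) — pure polynomial algebra, no analysis.
* `so_orthogonal_mem_iff_mem_span_isotropicWedge` (**nilpotent generation**): `f ∈ 𝔰𝔬(V₀)` iff `f`
  is a linear combination of isotropic wedges of `V₀`; `so_orthogonal_le_of_isotropicWedge_mem`: any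
  subspace of `End V` containing the isotropic wedges of `V₀` contains `𝔰𝔬(V₀)`. Proof: with a
  hyperbolic pair `u₀, v₀ ∈ V₀` (`SkewPlane.exists_hyperbolic_partner`) and `W = ⟨u₀,v₀⟩^⊥ ∩ V₀`,
  the wedges `u₀ ∧ w`, `v₀ ∧ w` (`w ∈ W`) are isotropic, and `u₀ ∧ v₀`, `w ∧ w'` are combinations
  of isotropic wedges such as `(u₀ + w − ½B(w,w) v₀) ∧ (w' − B(w,w') v₀)`
  (`SkewPlane.bwedge_mem_of_isotropicWedge_mem`); and every `f ∈ 𝔰𝔬(V₀)` is `½ Σᵢ f(dᵢ) ∧ bᵢ` for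
  `B|V₀`-dual bases (`SkewPlane.mem_of_bwedge_mem`, Mathlib's `LinearMap.BilinForm.dualBasis`).
* `forall_isotropicWedge_apply_eq_zero_iff` (**fixed vectors**): the vectors killed by all isotropic
  wedges of `V₀` (= by `𝔰𝔬(V₀)`, = fixed by all `u(t)`) are exactly `V₁`.
* `forall_commute_isotropicWedge_iff` (**centralizer**, Schur for the standard representation):
  `T ∈ End V` commutes with all isotropic wedges of `V₀` (= with `𝔰𝔬(V₀)`, = with all `u(t)`) iff
  `T` is a scalar on `V₀` and preserves `V₁` (`SkewPlane.scalar_of_forall_commute_bwedge`).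

How they enter §2.3 (not formalised here — needs Ratner's theorem, Borel–Harish-Chandra, Borel
density and the Lie correspondence, none in Mathlib): for the Ratner group `S ⊇ H` of a frame with
plane `V₁` and the lattice `Δ = Γ ∩ S` of integral matrices, Borel density makes every polynomial
identity of `Δ` hold at the unipotents `u(t) ∈ H`, hence (`unipotent_apply_eq_self_iff`,
`commute_unipotent_iff`, and the two theorems above) `Fix(Δ) ⊆ V₁` and
`Comm(Δ) ⊆ 𝕜·π₀ ⊕ End(V₁)`; if `S = SO(V₀)°` then `Fix(Δ) = V₁` is spanned by rational vectors,
and if `S = SO(V₀)°·SO(V₁)` the rational commutant forces `V₁` rational — excluding both for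
irrational planes.

## References

* [Verbitsky2017ErgodicErratum] M. Verbitsky, Ergodic complex structures on hyperkähler manifolds:
  an erratum, arXiv:1708.05802 (2017), §2.2 (Theorem "Ratner for `SO(a,b)`" and its proof: `H` is
  generated by unipotents), §2.3 (exclusion of `SO(a−2,b) × SO(2)`: "impossible, because `S` is
  generated by unipotents").
* [Morris2005Ratner] D. W. Morris, Ratner's Theorems on Unipotent Flows, Univ. of Chicago Press
  2005, Prop. 4.7.1 (Borel density theorem: the Zariski closure of a lattice contains every
  unipotent element), Def. 1.1.7 (unipotent one-parameter subgroups).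
-/

noncomputable section

attribute [local instance 100] LieRing.ofAssociativeRing

namespace Literature.Dynamics.Homogeneous

open Module

variable {𝕜 : Type*} [Field 𝕜] {V : Type*} [AddCommGroup V] [Module 𝕜 V]

-- The elementary skew endomorphism `u ∧_B w : x ↦ B(w,x) u − B(u,x) w` (local notation, as in
-- `OrthogonalGroupOrbitClosuresSubalgebras`).
local notation "ω⟦" B "; " u ", " w "⟧" =>
  (LinearMap.smulRight (B w) u - LinearMap.smulRight (B u) w)

namespace SkewPlane

section Nilpotent

variable [FiniteDimensional 𝕜 V] {B : LinearMap.BilinForm 𝕜 V} {V₁ : Submodule 𝕜 V}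

/-! ### Isotropic (nilpotent) wedges and nilpotent generation of `𝔰𝔬(V₀)` -/

omit [FiniteDimensional 𝕜 V] in
/-- Square of an isotropic wedge: `(u ∧ w)² x = −B(w,w) B(u,x) u` when `B(u,u) = B(u,w) = 0`.
[folklore] -/
theorem bwedge_mul_bwedge_apply_of_isotropic (hB : B.IsSymm) {u w : V} (huu : B u u = 0)
    (huw : B u w = 0) (x : V) :
    ((ω⟦B; u, w⟧ : Module.End 𝕜 V) * ω⟦B; u, w⟧) x = -(B w w * B u x) • u := by
  have hwu : B w u = 0 := by rw [hB.eq]; exact huw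
  rw [Module.End.mul_apply, bwedge_apply, bwedge_apply]
  simp only [map_sub, map_smul, smul_eq_mul, huu, huw, hwu]
  module

omit [FiniteDimensional 𝕜 V] in
/-- **Isotropic wedges are nilpotent**: `(u ∧ w)³ = 0` when `B(u,u) = B(u,w) = 0` (so `exp(t u∧w)`
is a polynomial, unipotent one-parameter group). [folklore] -/
theorem bwedge_pow_three_of_isotropic (hB : B.IsSymm) {u w : V} (huu : B u u = 0)
    (huw : B u w = 0) : (ω⟦B; u, w⟧ : Module.End 𝕜 V) ^ 3 = 0 := by
  ext x
  have hwu : B w u = 0 := by rw [hB.eq]; exact huw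
  rw [pow_three, Module.End.mul_apply, bwedge_mul_bwedge_apply_of_isotropic hB huu huw, map_smul,
    bwedge_apply, hwu, huu]
  simp

omit [FiniteDimensional 𝕜 V] in
/-- Isotropic wedges are nilpotent endomorphisms. [folklore] -/
theorem isNilpotent_bwedge_of_isotropic (hB : B.IsSymm) {u w : V} (huu : B u u = 0)
    (huw : B u w = 0) : IsNilpotent (ω⟦B; u, w⟧ : Module.End 𝕜 V) :=
  ⟨3, bwedge_pow_three_of_isotropic hB huu huw⟩

/-- A hyperbolic partner: a non-zero isotropic `u₀ ∈ V₀` has an isotropic `v₀ ∈ V₀` with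
`B(u₀, v₀) = 1` (characteristic `≠ 2`). [folklore] -/
theorem exists_hyperbolic_partner [NeZero (2 : 𝕜)] (hB : B.IsSymm) (hBn : B.Nondegenerate)
    (hV₁ : ∀ v ∈ V₁, B v v = 0 → v = 0) {u₀ : V} (hu₀ : u₀ ∈ B.orthogonal V₁) (hu₀0 : u₀ ≠ 0)
    (huu : B u₀ u₀ = 0) :
    ∃ v₀ ∈ B.orthogonal V₁, B u₀ v₀ = 1 ∧ B v₀ v₀ = 0 := by
  obtain ⟨w₀, hw₀, hw₀u⟩ := exists_B_eq_one hB hBn hV₁ hu₀ hu₀0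
  have huw₀ : B u₀ w₀ = 1 := by rw [hB.eq]; exact hw₀u
  refine ⟨w₀ - (B w₀ w₀ * (2 : 𝕜)⁻¹) • u₀,
    Submodule.sub_mem _ hw₀ (Submodule.smul_mem _ _ hu₀), ?_, ?_⟩
  · simp only [map_sub, map_smul, smul_eq_mul, huw₀, huu, mul_zero, sub_zero]
  · have h2 : (2 : 𝕜) ≠ 0 := two_ne_zero
    simp only [map_sub, map_smul, LinearMap.sub_apply, LinearMap.smul_apply, smul_eq_mul, hw₀u,
      huw₀, huu]
    field_simp
    ring

omit [FiniteDimensional 𝕜 V] in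
/-- Projection to `W = V₀ ∩ u₀^⊥ ∩ v₀^⊥` along the hyperbolic plane `⟨u₀, v₀⟩`. [folklore] -/
theorem B_hyperbolicProj_eq_zero (hB : B.IsSymm) {u₀ v₀ : V} (huu : B u₀ u₀ = 0)
    (huv : B u₀ v₀ = 1) (hvv : B v₀ v₀ = 0) (a : V) :
    B u₀ (a - B v₀ a • u₀ - B u₀ a • v₀) = 0 ∧ B v₀ (a - B v₀ a • u₀ - B u₀ a • v₀) = 0 := by
  have hvu : B v₀ u₀ = 1 := by rw [hB.eq]; exact huv
  constructor
  · simp only [map_sub, map_smul, smul_eq_mul, huu, huv, mul_zero, sub_zero, mul_one, sub_self]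
  · simp only [map_sub, map_smul, smul_eq_mul, hvu, hvv, mul_one, mul_zero, sub_self]

/-- **Nilpotent generation, wedge level.** A subspace of `End V` containing every ISOTROPIC wedge
`u ∧ w` (`u, w ∈ V₀`, `B(u,u) = B(u,w) = 0`) contains every wedge of two vectors of `V₀`, provided
`V₀ = V₁^⊥` contains a non-zero isotropic vector (`V₁` an anisotropic plane, `dim V ≥ 5`,
`char ≠ 2`). With a hyperbolic pair `u₀, v₀` and `W = ⟨u₀, v₀⟩^⊥ ∩ V₀`: the wedges `u₀ ∧ w`,
`v₀ ∧ w` (`w ∈ W`) are isotropic; `u₀ ∧ v₀` and `w ∧ w'` are differences of isotropic wedges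
`(u₀ + w − ½q(w) v₀) ∧ (w' − B(w,w') v₀)` and such — the Lie-algebra form of "`SO⁺(a−2,b)` is
generated by unipotents". [folklore] [cite: Verbitsky2017ErgodicErratum, §2.2 (proof of the Theorem)] -/
theorem bwedge_mem_of_isotropicWedge_mem [NeZero (2 : 𝕜)] (hB : B.IsSymm) (hBn : B.Nondegenerate)
    (hV₁ : ∀ v ∈ V₁, B v v = 0 → v = 0) (h2 : finrank 𝕜 V₁ = 2) (h5 : 5 ≤ finrank 𝕜 V)
    (hiso : ∃ u ∈ B.orthogonal V₁, u ≠ 0 ∧ B u u = 0) (N : Submodule 𝕜 (Module.End 𝕜 V))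
    (hN : ∀ u ∈ B.orthogonal V₁, ∀ w ∈ B.orthogonal V₁, B u u = 0 → B u w = 0 →
      (ω⟦B; u, w⟧ : Module.End 𝕜 V) ∈ N) :
    ∀ a ∈ B.orthogonal V₁, ∀ b ∈ B.orthogonal V₁, (ω⟦B; a, b⟧ : Module.End 𝕜 V) ∈ N := by
  obtain ⟨u₀, hu₀, hu₀0, huu⟩ := hiso
  obtain ⟨v₀, hv₀, huv, hvv⟩ := exists_hyperbolic_partner hB hBn hV₁ hu₀ hu₀0 huu
  have hvu : B v₀ u₀ = 1 := by rw [hB.eq]; exact huv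
  have h3 := three_le_finrank_orthogonal hBn h2 h5
  -- the hypothesis with the isotropic vector in the second slot
  have hN' : ∀ u ∈ B.orthogonal V₁, ∀ w ∈ B.orthogonal V₁, B w w = 0 → B u w = 0 →
      (ω⟦B; u, w⟧ : Module.End 𝕜 V) ∈ N := fun u hu w hw hww huw => by
    rw [← neg_neg (ω⟦B; u, w⟧ : Module.End 𝕜 V), ← bwedge_swap]
    exact N.neg_mem (hN w hw u hu hww (by rw [hB.eq]; exact huw))
  -- (iii) the boost `u₀ ∧ v₀`
  have huv_mem : (ω⟦B; u₀, v₀⟧ : Module.End 𝕜 V) ∈ N := by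
    -- an anisotropic `w ∈ W`
    obtain ⟨w, hw, hu₀w, hv₀w, hq⟩ :
        ∃ w ∈ B.orthogonal V₁, B u₀ w = 0 ∧ B v₀ w = 0 ∧ B w w ≠ 0 := by
      obtain ⟨a, ha, ha0, hau, hav⟩ := exists_ne_zero_mem_ker₂ (B.orthogonal V₁) h3 (B u₀) (B v₀)
      by_cases haa : B a a = 0
      · obtain ⟨b, hb, hba⟩ := exists_B_eq_one hB hBn hV₁ ha ha0
        obtain ⟨hub', hvb'⟩ := B_hyperbolicProj_eq_zero hB huu huv hvv b
        have hua : B u₀ a = 0 := hau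
        have hva : B v₀ a = 0 := hav
        set b' := b - B v₀ b • u₀ - B u₀ b • v₀ with hb'def
        have hb'mem : b' ∈ B.orthogonal V₁ :=
          Submodule.sub_mem _ (Submodule.sub_mem _ hb (Submodule.smul_mem _ _ hu₀))
            (Submodule.smul_mem _ _ hv₀)
        have hb'a : B b' a = 1 := by
          simp only [hb'def, map_sub, map_smul, LinearMap.sub_apply, LinearMap.smul_apply,
            smul_eq_mul, hba, hua, hva, mul_zero, sub_zero]
        by_cases hbb : B b' b' = 0
        · refine ⟨a + b', Submodule.add_mem _ ha hb'mem, ?_, ?_, ?_⟩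
          · rw [map_add, hua, hub', add_zero]
          · rw [map_add, hva, hvb', add_zero]
          · have hab' : B a b' = 1 := by rw [hB.eq]; exact hb'a
            have h2 : B (a + b') (a + b') = 2 := by
              simp only [map_add, LinearMap.add_apply, haa, hbb, hb'a, hab', zero_add, add_zero]
              exact one_add_one_eq_two
            rw [h2]
            exact two_ne_zero
        · exact ⟨_, hb'mem, hub', hvb', hbb⟩
      · exact ⟨a, ha, hau, hav, haa⟩
    have hwu₀ : B w u₀ = 0 := by rw [hB.eq]; exact hu₀w
    have hwv₀ : B w v₀ = 0 := by rw [hB.eq]; exact hv₀w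
    set s : 𝕜 := -(B w w * (2 : 𝕜)⁻¹) with hs
    have h2ne : (2 : 𝕜) ≠ 0 := two_ne_zero
    have hy_iso : B (u₀ + w + s • v₀) (u₀ + w + s • v₀) = 0 := by
      simp only [map_add, map_smul, LinearMap.add_apply, LinearMap.smul_apply, smul_eq_mul, huu,
        hu₀w, huv, hwu₀, hwv₀, hvu, hv₀w, hvv, hs]
      field_simp
      ring
    have hy_orth : B (u₀ + w + s • v₀) (w - B w w • v₀) = 0 := by
      simp only [map_add, map_sub, map_smul, LinearMap.add_apply, LinearMap.smul_apply,
        smul_eq_mul, hu₀w, huv, hwv₀, hv₀w, hvv]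
      ring
    have hn := hN _ (Submodule.add_mem _ (Submodule.add_mem _ hu₀ hw) (Submodule.smul_mem _ _ hv₀))
      _ (Submodule.sub_mem _ hw (Submodule.smul_mem _ _ hv₀)) hy_iso hy_orth
    have hexp : (ω⟦B; u₀ + w + s • v₀, w - B w w • v₀⟧ : Module.End 𝕜 V) =
        ω⟦B; u₀, w⟧ - (B w w) • ω⟦B; u₀, v₀⟧ - (B w w) • ω⟦B; w, v₀⟧ + s • ω⟦B; v₀, w⟧ := by
      ext x
      simp only [map_add, map_sub, map_smul, LinearMap.add_apply, LinearMap.sub_apply,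
        LinearMap.smul_apply, LinearMap.smulRight_apply]
      module
    rw [hexp] at hn
    have h1 : (ω⟦B; u₀, w⟧ : Module.End 𝕜 V) ∈ N := hN u₀ hu₀ w hw huu hu₀w
    have h2' : (ω⟦B; w, v₀⟧ : Module.End 𝕜 V) ∈ N := hN' w hw v₀ hv₀ hvv hwv₀
    have h3' : (ω⟦B; v₀, w⟧ : Module.End 𝕜 V) ∈ N := hN v₀ hv₀ w hw hvv hv₀w
    have hq_mem : (B w w) • (ω⟦B; u₀, v₀⟧ : Module.End 𝕜 V) ∈ N := by
      have := N.sub_mem (N.add_mem (N.sub_mem h1 (N.smul_mem (B w w) h2')) (N.smul_mem s h3')) hn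
      convert this using 1
      module
    have := N.smul_mem (B w w)⁻¹ hq_mem
    rwa [smul_smul, inv_mul_cancel₀ hq, one_smul] at this
  -- (iv) wedges inside `W`
  have hWW : ∀ w ∈ B.orthogonal V₁, ∀ w' ∈ B.orthogonal V₁, B u₀ w = 0 → B v₀ w = 0 →
      B u₀ w' = 0 → B v₀ w' = 0 → (ω⟦B; w', w⟧ : Module.End 𝕜 V) ∈ N :=
      fun w hw w' hw' hu₀w hv₀w hu₀w' hv₀w' => by
    have hwu₀ : B w u₀ = 0 := by rw [hB.eq]; exact hu₀w
    have hwv₀ : B w v₀ = 0 := by rw [hB.eq]; exact hv₀w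
    have hw'u₀ : B w' u₀ = 0 := by rw [hB.eq]; exact hu₀w'
    have hw'v₀ : B w' v₀ = 0 := by rw [hB.eq]; exact hv₀w'
    set s' : 𝕜 := -(B w' w' * (2 : 𝕜)⁻¹) with hs'
    have h2ne : (2 : 𝕜) ≠ 0 := two_ne_zero
    have hy_iso : B (u₀ + w' + s' • v₀) (u₀ + w' + s' • v₀) = 0 := by
      simp only [map_add, map_smul, LinearMap.add_apply, LinearMap.smul_apply, smul_eq_mul, huu,
        hu₀w', huv, hw'u₀, hw'v₀, hvu, hv₀w', hvv, hs']
      field_simp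
      ring
    have hy_orth : B (u₀ + w' + s' • v₀) (w - B w' w • v₀) = 0 := by
      simp only [map_add, map_sub, map_smul, LinearMap.add_apply, LinearMap.smul_apply,
        smul_eq_mul, hu₀w, huv, hw'v₀, hv₀w, hvv]
      ring
    have hm := hN _ (Submodule.add_mem _ (Submodule.add_mem _ hu₀ hw') (Submodule.smul_mem _ _ hv₀))
      _ (Submodule.sub_mem _ hw (Submodule.smul_mem _ _ hv₀)) hy_iso hy_orth
    have hexp : (ω⟦B; u₀ + w' + s' • v₀, w - B w' w • v₀⟧ : Module.End 𝕜 V) =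
        ω⟦B; u₀, w⟧ - (B w' w) • ω⟦B; u₀, v₀⟧ + ω⟦B; w', w⟧ - (B w' w) • ω⟦B; w', v₀⟧
          + s' • ω⟦B; v₀, w⟧ := by
      ext x
      simp only [map_add, map_sub, map_smul, LinearMap.add_apply, LinearMap.sub_apply,
        LinearMap.smul_apply, LinearMap.smulRight_apply]
      module
    rw [hexp] at hm
    have h1 : (ω⟦B; u₀, w⟧ : Module.End 𝕜 V) ∈ N := hN u₀ hu₀ w hw huu hu₀w
    have h2' : (ω⟦B; w', v₀⟧ : Module.End 𝕜 V) ∈ N := hN' w' hw' v₀ hv₀ hvv hw'v₀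
    have h3' : (ω⟦B; v₀, w⟧ : Module.End 𝕜 V) ∈ N := hN v₀ hv₀ w hw hvv hv₀w
    have := N.sub_mem hm (N.add_mem (N.sub_mem (N.sub_mem h1 (N.smul_mem (B w' w) huv_mem))
      (N.smul_mem (B w' w) h2')) (N.smul_mem s' h3'))
    convert this using 1
    module
  -- (v) spreading over `V₀ = W ⊕ ⟨u₀, v₀⟩`, second slot
  have key : ∀ a : V, (ω⟦B; a, u₀⟧ : Module.End 𝕜 V) ∈ N → (ω⟦B; a, v₀⟧ : Module.End 𝕜 V) ∈ N →
      (∀ w ∈ B.orthogonal V₁, B u₀ w = 0 → B v₀ w = 0 → (ω⟦B; a, w⟧ : Module.End 𝕜 V) ∈ N) →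
      ∀ b ∈ B.orthogonal V₁, (ω⟦B; a, b⟧ : Module.End 𝕜 V) ∈ N := fun a hau hav haw b hb => by
    obtain ⟨hub, hvb⟩ := B_hyperbolicProj_eq_zero hB huu huv hvv b
    have hwb : b - B v₀ b • u₀ - B u₀ b • v₀ ∈ B.orthogonal V₁ :=
      Submodule.sub_mem _ (Submodule.sub_mem _ hb (Submodule.smul_mem _ _ hu₀))
        (Submodule.smul_mem _ _ hv₀)
    have hsplit : (ω⟦B; a, b⟧ : Module.End 𝕜 V) = ω⟦B; a, b - B v₀ b • u₀ - B u₀ b • v₀⟧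
        + (B v₀ b) • ω⟦B; a, u₀⟧ + (B u₀ b) • ω⟦B; a, v₀⟧ := by
      ext x
      simp only [map_sub, map_smul, LinearMap.add_apply, LinearMap.sub_apply,
        LinearMap.smul_apply, LinearMap.smulRight_apply]
      module
    rw [hsplit]
    exact N.add_mem (N.add_mem (haw _ hwb hub hvb) (N.smul_mem _ hau)) (N.smul_mem _ hav)
  have hswap : ∀ a b : V, (ω⟦B; a, b⟧ : Module.End 𝕜 V) ∈ N → (ω⟦B; b, a⟧ : Module.End 𝕜 V) ∈ N :=
    fun a b h => by rw [bwedge_swap]; exact N.neg_mem h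
  -- first slot `u₀`, `v₀`, `w ∈ W`, second slot arbitrary
  have hU : ∀ b ∈ B.orthogonal V₁, (ω⟦B; u₀, b⟧ : Module.End 𝕜 V) ∈ N :=
    key u₀ (by rw [bwedge_self]; exact N.zero_mem) huv_mem
      (fun w hw hu _ => hN u₀ hu₀ w hw huu hu)
  have hV : ∀ b ∈ B.orthogonal V₁, (ω⟦B; v₀, b⟧ : Module.End 𝕜 V) ∈ N :=
    key v₀ (hswap _ _ huv_mem) (by rw [bwedge_self]; exact N.zero_mem)
      (fun w hw _ hv => hN v₀ hv₀ w hw hvv hv)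
  have hW : ∀ w ∈ B.orthogonal V₁, B u₀ w = 0 → B v₀ w = 0 →
      ∀ b ∈ B.orthogonal V₁, (ω⟦B; w, b⟧ : Module.End 𝕜 V) ∈ N := fun w hw hu hv =>
    key w (hswap _ _ (hN u₀ hu₀ w hw huu hu)) (hswap _ _ (hN v₀ hv₀ w hw hvv hv))
      (fun w' hw' hu' hv' => hWW w' hw' w hw hu' hv' hu hv)
  -- both slots arbitrary
  intro a ha b hb
  refine hswap _ _ (key b (hswap _ _ (hU b hb)) (hswap _ _ (hV b hb))
    (fun w hw hu hv => hswap _ _ (hW w hw hu hv b hb)) a ha)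


/-- **Wedges span `𝔰𝔬(V₀)`.** A subspace of `End V` containing all wedges `a ∧ b` (`a, b ∈ V₀`)
contains every skew endomorphism killing `V₁` (i.e. all of `𝔰𝔬(V₀)`): for `B|V₀`-dual bases
`(bᵢ)`, `(dᵢ)` of `V₀` one has `f = ½ Σᵢ f(dᵢ) ∧ bᵢ`. [folklore] -/
theorem mem_of_bwedge_mem [NeZero (2 : 𝕜)] (hB : B.IsSymm) (hBn : B.Nondegenerate)
    (hV₁ : ∀ v ∈ V₁, B v v = 0 → v = 0) (N : Submodule 𝕜 (Module.End 𝕜 V))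
    (hN : ∀ a ∈ B.orthogonal V₁, ∀ b ∈ B.orthogonal V₁, (ω⟦B; a, b⟧ : Module.End 𝕜 V) ∈ N)
    {f : Module.End 𝕜 V} (hf : f ∈ skewAdjointLieSubalgebra B) (hf1 : ∀ v ∈ V₁, f v = 0) :
    f ∈ N := by
  classical
  have hf' := (mem_skewAdjointLieSubalgebra_iff B f).1 hf
  -- `f` takes values in `V₀`
  have hfV₀ : ∀ x, f x ∈ B.orthogonal V₁ := fun x =>
    LinearMap.BilinForm.mem_orthogonal_iff.2 fun e he => by
      show B e (f x) = 0
      have h := hf' e x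
      rw [hf1 e he, map_zero, LinearMap.zero_apply] at h
      exact (neg_eq_zero.1 h.symm)
  -- non-degeneracy and symmetry of `B₀ = B|V₀`
  set V₀ := B.orthogonal V₁ with hV₀def
  have hc := isCompl_orthogonal_of_anisotropic hB hV₁
  have hoo : B.orthogonal V₀ = V₁ := LinearMap.BilinForm.orthogonal_orthogonal hBn hB.isRefl V₁
  have hdisj : Disjoint V₀ (B.orthogonal V₀) := by rw [hoo]; exact hc.symm.disjoint
  have hB₀n : (B.restrict V₀).Nondegenerate :=
    B.nondegenerate_restrict_of_disjoint_orthogonal hB.isRefl hdisj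
  have hB₀s : (B.restrict V₀).IsSymm := ⟨fun x y => hB.eq x y⟩
  set b := Module.finBasis 𝕜 V₀ with hbdef
  set d := (B.restrict V₀).dualBasis hB₀n b with hddef
  have hE : (B.restrict V₀).dualBasis hB₀n d = b :=
    LinearMap.BilinForm.dualBasis_dualBasis hB₀n hB₀s b
  -- the two expansions
  have hexp_d : ∀ z : V₀, ∑ i, B (b i) z • (d i : V) = z := fun z => by
    have h := congr_arg Subtype.val (d.sum_repr z)
    rw [Submodule.coe_sum] at h
    conv_rhs => rw [← h]
    refine Finset.sum_congr rfl fun i _ => ?_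
    rw [Submodule.coe_smul, LinearMap.BilinForm.dualBasis_repr_apply,
      LinearMap.BilinForm.restrict_apply, LinearMap.domRestrict_apply, hB.eq]
  have hexp_b : ∀ z : V₀, ∑ i, B (d i) z • (b i : V) = z := fun z => by
    have h := congr_arg Subtype.val (b.sum_repr z)
    rw [Submodule.coe_sum] at h
    conv_rhs => rw [← h]
    refine Finset.sum_congr rfl fun i _ => ?_
    have hr := LinearMap.BilinForm.dualBasis_repr_apply (B := B.restrict V₀) hB₀n d z i
    rw [hE] at hr
    rw [Submodule.coe_smul, hr, LinearMap.BilinForm.restrict_apply, LinearMap.domRestrict_apply,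
      hB.eq]
  -- `Σᵢ f(dᵢ) ∧ bᵢ = 2 f`
  have hg : ∑ i, (ω⟦B; f (d i : V), (b i : V)⟧ : Module.End 𝕜 V) ∈ N :=
    N.sum_mem fun i _ => hN _ (hfV₀ _) _ (b i).2
  have hgf : ∑ i, (ω⟦B; f (d i : V), (b i : V)⟧ : Module.End 𝕜 V) = (2 : 𝕜) • f := by
    ext x
    obtain ⟨y, hy, z, hz, rfl⟩ := exists_add_eq hB hV₁ x
    have hfy : f y = 0 := hf1 y hy
    have h1 : ∀ i, B (b i : V) (y + z) = B (b i : V) z := fun i => by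
      rw [map_add, B_eq_zero_of_mem_orthogonal_of_mem hB hy (b i).2, zero_add]
    have h2 : ∀ i, B (f (d i)) (y + z) = -B (d i : V) (f z) := fun i => by
      rw [map_add, B_eq_zero_of_mem_orthogonal_of_mem hB hy (hfV₀ _), zero_add, hf']
    rw [LinearMap.sum_apply, LinearMap.smul_apply, map_add, hfy, zero_add]
    simp only [bwedge_apply, h1, h2, neg_smul, sub_neg_eq_add, Finset.sum_add_distrib]
    have hA : ∑ i, B (b i : V) z • f (d i) = f z := by
      have := congr_arg f (hexp_d ⟨z, hz⟩)
      rw [map_sum] at this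
      simpa only [map_smul] using this
    have hB' : ∑ i, B (d i : V) (f z) • (b i : V) = f z := hexp_b ⟨f z, hfV₀ z⟩
    rw [hA, hB', two_smul]
  have h2ne : (2 : 𝕜) ≠ 0 := two_ne_zero
  have := N.smul_mem (2 : 𝕜)⁻¹ hg
  rwa [hgf, smul_smul, inv_mul_cancel₀ h2ne, one_smul] at this

/-- All wedges of `V₀` kill `x` only if `x ∈ V₁` (`dim V₀ ≥ 2`, `V₀` non-degenerate). [folklore] -/
theorem mem_of_forall_bwedge_apply_eq_zero (hB : B.IsSymm) (hBn : B.Nondegenerate)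
    (hV₁ : ∀ v ∈ V₁, B v v = 0 → v = 0) (h2 : finrank 𝕜 V₁ = 2) (h5 : 5 ≤ finrank 𝕜 V) {x : V}
    (hx : ∀ a ∈ B.orthogonal V₁, ∀ b ∈ B.orthogonal V₁, (ω⟦B; a, b⟧ : Module.End 𝕜 V) x = 0) :
    x ∈ V₁ := by
  obtain ⟨y, hy, z, hz, rfl⟩ := exists_add_eq hB hV₁ x
  suffices hz0 : z = 0 by rw [hz0, add_zero]; exact hy
  by_contra hz0
  have h3 := three_le_finrank_orthogonal hBn h2 h5
  obtain ⟨w, hw, hwz⟩ := exists_B_eq_one hB hBn hV₁ hz hz0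
  obtain ⟨u, hu, hu0, huz⟩ := exists_ne_zero_mem_ker₁ (B.orthogonal V₁) (by omega) (B z)
  have huz' : B u z = 0 := by rw [hB.eq]; exact huz
  have h := hx u hu w hw
  rw [bwedge_apply, map_add, map_add, B_eq_zero_of_mem_orthogonal_of_mem hB hy hw,
    B_eq_zero_of_mem_orthogonal_of_mem hB hy hu, zero_add, zero_add, hwz, huz', one_smul,
    zero_smul, sub_zero] at h
  exact hu0 h

/-- Every vector is a value of a wedge at a vector of `V₀`: `v = (v ∧ w) x` with
`x ∈ V₀ ∩ v^⊥ ∖ 0`, `w ∈ V₀`, `B(w, x) = 1`. [folklore] -/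
theorem exists_bwedge_apply_eq (hB : B.IsSymm) (hBn : B.Nondegenerate)
    (hV₁ : ∀ v ∈ V₁, B v v = 0 → v = 0) (h2 : finrank 𝕜 V₁ = 2) (h5 : 5 ≤ finrank 𝕜 V) (v : V) :
    ∃ x ∈ B.orthogonal V₁, ∃ w ∈ B.orthogonal V₁, x ≠ 0 ∧ B v x = 0 ∧ B w x = 1 ∧
      (ω⟦B; v, w⟧ : Module.End 𝕜 V) x = v := by
  have h3 := three_le_finrank_orthogonal hBn h2 h5
  obtain ⟨x, hx, hx0, hvx⟩ := exists_ne_zero_mem_ker₁ (B.orthogonal V₁) (by omega) (B v)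
  obtain ⟨w, hw, hwx⟩ := exists_B_eq_one hB hBn hV₁ hx hx0
  refine ⟨x, hx, w, hw, hx0, hvx, hwx, ?_⟩
  rw [bwedge_apply, hwx, hvx, one_smul, zero_smul, sub_zero]

/-- An endomorphism commuting with all wedges of `V₀` preserves `V₁`, preserves `V₀` and is a
scalar on `V₀` (`dim V₀ ≥ 3`; Schur for the standard representation of `𝔰𝔬(V₀)`). [folklore] -/
theorem scalar_of_forall_commute_bwedge (hB : B.IsSymm) (hBn : B.Nondegenerate)
    (hV₁ : ∀ v ∈ V₁, B v v = 0 → v = 0) (h2 : finrank 𝕜 V₁ = 2) (h5 : 5 ≤ finrank 𝕜 V)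
    {T : Module.End 𝕜 V}
    (hT : ∀ a ∈ B.orthogonal V₁, ∀ b ∈ B.orthogonal V₁,
      T * (ω⟦B; a, b⟧ : Module.End 𝕜 V) = (ω⟦B; a, b⟧ : Module.End 𝕜 V) * T) :
    (∃ α : 𝕜, ∀ v ∈ B.orthogonal V₁, T v = α • v) ∧ (∀ e ∈ V₁, T e ∈ V₁) := by
  have h3 := three_le_finrank_orthogonal hBn h2 h5
  have hT' : ∀ a ∈ B.orthogonal V₁, ∀ b ∈ B.orthogonal V₁, ∀ x,
      T ((ω⟦B; a, b⟧ : Module.End 𝕜 V) x) = (ω⟦B; a, b⟧ : Module.End 𝕜 V) (T x) :=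
    fun a ha b hb x => by
    have := congr_arg (fun S : Module.End 𝕜 V => S x) (hT a ha b hb)
    simpa only [Module.End.mul_apply] using this
  -- `T(V₁) ⊆ V₁`
  have hT1 : ∀ e ∈ V₁, T e ∈ V₁ := fun e he =>
    mem_of_forall_bwedge_apply_eq_zero hB hBn hV₁ h2 h5 fun a ha b hb => by
      rw [← hT' a ha b hb e, bwedge_apply_of_mem hB ha hb he, map_zero]
  -- `T(V₀) ⊆ V₀`
  have hT0 : ∀ v ∈ B.orthogonal V₁, T v ∈ B.orthogonal V₁ := fun v hv => by
    obtain ⟨x, hx, w, hw, -, -, -, hvx⟩ := exists_bwedge_apply_eq hB hBn hV₁ h2 h5 v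
    rw [← hvx, hT' v hv w hw x, bwedge_apply]
    exact Submodule.sub_mem _ (Submodule.smul_mem _ _ hv) (Submodule.smul_mem _ _ hw)
  -- every `v ∈ V₀` is an eigenvector
  have heig : ∀ v ∈ B.orthogonal V₁, v ≠ 0 → ∃ c : 𝕜, T v = c • v := fun v hv hv0 => by
    obtain ⟨x, hx, w, hw, hx0, hvx, hwx, hvwx⟩ := exists_bwedge_apply_eq hB hBn hV₁ h2 h5 v
    -- `T v = B(w, T x) v − B(v, T x) w`; the second coefficient vanishes
    have hTv : T v = B w (T x) • v - B v (T x) • w := by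
      conv_lhs => rw [← hvwx]
      rw [hT' v hv w hw x, bwedge_apply]
    -- perturb `w` by `w₁ ∈ V₀ ∩ x^⊥ ∩ w₂^⊥`, where `B(w₂, v) = 1`
    obtain ⟨w₂, hw₂, hw₂v⟩ := exists_B_eq_one hB hBn hV₁ hv hv0
    obtain ⟨w₁, hw₁, hw₁0, hxw₁, hw₂w₁⟩ :=
      exists_ne_zero_mem_ker₂ (B.orthogonal V₁) h3 (B x) (B w₂)
    have hw₁x : B w₁ x = 0 := by rw [hB.eq]; exact hxw₁
    have hw'x : B (w + w₁) x = 1 := by rw [map_add, LinearMap.add_apply, hwx, hw₁x, add_zero]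
    have hvwx' : (ω⟦B; v, w + w₁⟧ : Module.End 𝕜 V) x = v := by
      rw [bwedge_apply, hw'x, hvx, one_smul, zero_smul, sub_zero]
    have hTv' : T v = B (w + w₁) (T x) • v - B v (T x) • (w + w₁) := by
      conv_lhs => rw [← hvwx']
      rw [hT' v hv (w + w₁) (Submodule.add_mem _ hw hw₁) x, bwedge_apply]
    -- subtracting: `B(w₁, T x) v = B(v, T x) w₁`
    have hdiff : B w₁ (T x) • v = B v (T x) • w₁ := by
      have h := hTv.symm.trans hTv'
      rw [map_add, LinearMap.add_apply] at h
      have key : B w₁ (T x) • v - B v (T x) • w₁ =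
          ((B w (T x) + B w₁ (T x)) • v - B v (T x) • (w + w₁)) - (B w (T x) • v - B v (T x) • w) := by
        module
      rw [← h, sub_self] at key
      exact sub_eq_zero.1 key
    -- pair with `w₂`: `B(w₁, T x) = 0`, hence `B(v, T x) = 0`
    have hco : B w₁ (T x) = 0 := by
      have := congr_arg (B w₂) hdiff
      rw [map_smul, map_smul, smul_eq_mul, smul_eq_mul, hw₂v, hw₂w₁, mul_one, mul_zero] at this
      exact this
    have hμ : B v (T x) = 0 := by
      rw [hco, zero_smul] at hdiff
      rcases smul_eq_zero.1 hdiff.symm with h | h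
      · exact h
      · exact (hw₁0 h).elim
    exact ⟨B w (T x), by rw [hTv, hμ, zero_smul, sub_zero]⟩
  refine ⟨?_, hT1⟩
  -- a common eigenvalue
  obtain ⟨v₁, hv₁, hv₁0, -⟩ := exists_ne_zero_mem_ker₁ (B.orthogonal V₁) (by omega) (0 : V →ₗ[𝕜] 𝕜)
  obtain ⟨α, hα⟩ := heig v₁ hv₁ hv₁0
  refine ⟨α, fun v hv => ?_⟩
  by_cases hvs : ∃ c : 𝕜, v = c • v₁
  · obtain ⟨c, rfl⟩ := hvs
    rw [map_smul, hα, smul_comm]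
  · have hv0 : v ≠ 0 := fun h => hvs ⟨0, by rw [h, zero_smul]⟩
    obtain ⟨β, hβ⟩ := heig v hv hv0
    have hsum0 : v + v₁ ≠ 0 := fun h => hvs ⟨-1, by
      rw [neg_one_smul]; exact eq_neg_of_add_eq_zero_left h⟩
    obtain ⟨γ, hγ⟩ := heig (v + v₁) (Submodule.add_mem _ hv hv₁) hsum0
    rw [map_add, hα, hβ, smul_add] at hγ
    -- `(β − γ) v = (γ − α) v₁`; independence forces `β = γ = α`
    have hrel : (β - γ) • v = (γ - α) • v₁ := by
      rw [sub_smul, sub_smul]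
      have := hγ
      rw [← sub_eq_zero] at this ⊢
      rw [← this]
      module
    by_cases hβγ : β - γ = 0
    · rw [hβγ, zero_smul] at hrel
      rcases smul_eq_zero.1 hrel.symm with h | h
      · have hβα : β = α := by
          have := sub_eq_zero.1 hβγ
          have := sub_eq_zero.1 h
          subst_vars; rfl
        rw [hβ, hβα]
      · exact (hv₁0 h).elim
    · exfalso
      refine hvs ⟨(β - γ)⁻¹ * (γ - α), ?_⟩
      rw [mul_smul, ← hrel, smul_smul, inv_mul_cancel₀ hβγ, one_smul]


/-! ### The unipotent one-parameter groups `t ↦ 1 + tN + ½t²N²` of a cube-zero `N` -/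

section Unipotent

variable {N : Module.End 𝕜 V}

omit [FiniteDimensional 𝕜 V] in
/-- Group law: `u(s) u(t) = u(s+t)` for `u(t) = 1 + tN + ½t²N²`, `N³ = 0` (this is `exp(tN)`).
[folklore] -/
theorem unipotent_mul_unipotent [NeZero (2 : 𝕜)] (hN3 : N ^ 3 = 0) (s t : 𝕜) :
    ((1 : Module.End 𝕜 V) + s • N + (s ^ 2 * 2⁻¹) • (N * N)) *
        ((1 : Module.End 𝕜 V) + t • N + (t ^ 2 * 2⁻¹) • (N * N)) =
      (1 : Module.End 𝕜 V) + (s + t) • N + ((s + t) ^ 2 * 2⁻¹) • (N * N) := by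
  have h2 : (2 : 𝕜) ≠ 0 := two_ne_zero
  have e1 : N * (N * N) = 0 := by rw [← pow_three]; exact hN3
  simp only [mul_add, add_mul, one_mul, mul_one, smul_mul_assoc, mul_smul_comm, mul_assoc,
    e1, mul_zero, smul_zero, add_zero]
  match_scalars
  · rfl
  · ring
  · field_simp
    ring

omit [FiniteDimensional 𝕜 V] in
/-- `u(0) = 1`. [folklore] -/
theorem unipotent_zero :
    (1 : Module.End 𝕜 V) + (0 : 𝕜) • N + ((0 : 𝕜) ^ 2 * 2⁻¹) • (N * N) = 1 := by
  simp

omit [FiniteDimensional 𝕜 V] in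
/-- `u(t) − 1` is nilpotent (cube zero): the `u(t)` are unipotent. [folklore] -/
theorem unipotent_sub_one_pow_three (hN3 : N ^ 3 = 0) (t : 𝕜) :
    ((1 : Module.End 𝕜 V) + t • N + (t ^ 2 * 2⁻¹) • (N * N) - 1) ^ 3 = 0 := by
  have hc : Commute N (t • (1 : Module.End 𝕜 V) + (t ^ 2 * 2⁻¹) • N) :=
    ((Commute.one_right N).smul_right t).add_right ((Commute.refl N).smul_right _)
  have heq : (1 : Module.End 𝕜 V) + t • N + (t ^ 2 * 2⁻¹) • (N * N) - 1 =
      N * (t • (1 : Module.End 𝕜 V) + (t ^ 2 * 2⁻¹) • N) := by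
    rw [mul_add, mul_smul_comm, mul_one, mul_smul_comm]
    abel
  rw [heq, hc.mul_pow, hN3, zero_mul]

omit [FiniteDimensional 𝕜 V] in
/-- The `u(t)` are `B`-isometries when `N` is skew. [folklore] -/
theorem B_unipotent_apply [NeZero (2 : 𝕜)] (hN3 : N ^ 3 = 0) (hN : ∀ x y, B (N x) y = -B x (N y))
    (t : 𝕜) (x y : V) :
    B (((1 : Module.End 𝕜 V) + t • N + (t ^ 2 * 2⁻¹) • (N * N)) x)
        (((1 : Module.End 𝕜 V) + t • N + (t ^ 2 * 2⁻¹) • (N * N)) y) = B x y := by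
  have h2' : (2 : 𝕜) ≠ 0 := two_ne_zero
  have hN3' : ∀ z, N (N (N z)) = 0 := fun z => by
    have := congr_arg (fun S : Module.End 𝕜 V => S z) hN3
    simpa only [pow_three, Module.End.mul_apply, LinearMap.zero_apply] using this
  have h1 : B (N x) y = -B x (N y) := hN x y
  have h2 : B (N x) (N y) = -B x (N (N y)) := hN x (N y)
  have h3 : B (N x) (N (N y)) = 0 := by rw [hN, hN3', map_zero, neg_zero]
  have h4 : B (N (N x)) y = B x (N (N y)) := by rw [hN, hN, neg_neg]
  have h5 : B (N (N x)) (N y) = 0 := by rw [hN, hN, hN3', map_zero, neg_neg]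
  have h6 : B (N (N x)) (N (N y)) = 0 := by rw [hN, hN3', map_zero, neg_zero]
  simp only [LinearMap.add_apply, LinearMap.smul_apply, Module.End.one_apply, Module.End.mul_apply,
    map_add, map_smul, smul_eq_mul, h1, h2, h3, h4, h5, h6]
  field_simp
  ring

omit [FiniteDimensional 𝕜 V] in
/-- The `u(t)` fix every vector killed by `N`. [folklore] -/
theorem unipotent_apply_of_apply_eq_zero (t : 𝕜) {x : V} (hx : N x = 0) :
    ((1 : Module.End 𝕜 V) + t • N + (t ^ 2 * 2⁻¹) • (N * N)) x = x := by
  simp [hx]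

omit [FiniteDimensional 𝕜 V] in
/-- **Fixed vectors of a unipotent = kernel of its logarithm**: for `t ≠ 0`, `u(t) x = x` iff
`N x = 0`. [folklore] -/
theorem unipotent_apply_eq_self_iff (hN3 : N ^ 3 = 0) {t : 𝕜} (ht : t ≠ 0) (x : V) :
    ((1 : Module.End 𝕜 V) + t • N + (t ^ 2 * 2⁻¹) • (N * N)) x = x ↔ N x = 0 := by
  refine ⟨fun h => ?_, unipotent_apply_of_apply_eq_zero t⟩
  have hN3' : N (N (N x)) = 0 := by
    have := congr_arg (fun S : Module.End 𝕜 V => S x) hN3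
    simpa only [pow_three, Module.End.mul_apply, LinearMap.zero_apply] using this
  have h' : t • N x + (t ^ 2 * 2⁻¹) • N (N x) = 0 := by
    simpa only [LinearMap.add_apply, LinearMap.smul_apply, Module.End.one_apply,
      Module.End.mul_apply, add_assoc, add_eq_left] using h
  -- apply `N`: `t N²x = 0`
  have hNN : N (N x) = 0 := by
    have := congr_arg N h'
    rw [map_add, map_smul, map_smul, hN3', smul_zero, add_zero, map_zero] at this
    exact (smul_eq_zero.1 this).resolve_left ht
  rw [hNN, smul_zero, add_zero] at h'
  exact (smul_eq_zero.1 h').resolve_left ht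

omit [FiniteDimensional 𝕜 V] in
/-- **Centralizer of a unipotent = centralizer of its logarithm**: for `t ≠ 0`, `T` commutes with
`u(t)` iff it commutes with `N` (`N = t⁻¹ (M − ½M²)` for `M = u(t) − 1`). [folklore] -/
theorem commute_unipotent_iff [NeZero (2 : 𝕜)] (hN3 : N ^ 3 = 0) {t : 𝕜} (ht : t ≠ 0)
    (T : Module.End 𝕜 V) :
    T * ((1 : Module.End 𝕜 V) + t • N + (t ^ 2 * 2⁻¹) • (N * N)) =
        ((1 : Module.End 𝕜 V) + t • N + (t ^ 2 * 2⁻¹) • (N * N)) * T ↔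
      T * N = N * T := by
  have h2 : (2 : 𝕜) ≠ 0 := two_ne_zero
  have e1 : N * (N * N) = 0 := by rw [← pow_three]; exact hN3
  set M : Module.End 𝕜 V := t • N + (t ^ 2 * 2⁻¹) • (N * N) with hM
  have hU : (1 : Module.End 𝕜 V) + t • N + (t ^ 2 * 2⁻¹) • (N * N) = 1 + M := by
    rw [hM, add_assoc]
  have hMM : M * M = (t ^ 2) • (N * N) := by
    simp only [hM, mul_add, add_mul, smul_mul_assoc, mul_smul_comm, smul_smul, mul_assoc, e1,
      mul_zero, smul_zero, add_zero]
    rw [sq]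
  have hNM : N = t⁻¹ • (M - (2⁻¹ : 𝕜) • (M * M)) := by
    rw [hMM, hM, smul_smul]
    match_scalars
    · field_simp
    · field_simp
      ring
  rw [hU]
  constructor
  · intro h
    have hTM : T * M = M * T := by
      have := h
      rwa [mul_add, add_mul, mul_one, one_mul, add_right_inj] at this
    have hTMM : T * (M * M) = M * M * T := by rw [← mul_assoc, hTM, mul_assoc, hTM, mul_assoc]
    rw [hNM, mul_smul_comm, smul_mul_assoc, mul_sub, sub_mul, mul_smul_comm, smul_mul_assoc, hTM,
      hTMM]
  · intro h
    have hTNN : T * (N * N) = N * N * T := by rw [← mul_assoc, h, mul_assoc, h, mul_assoc]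
    rw [hM, mul_add, add_mul, mul_one, one_mul, mul_add, add_mul, mul_smul_comm, smul_mul_assoc, h,
      mul_smul_comm, smul_mul_assoc, hTNN]

end Unipotent

end Nilpotent

end SkewPlane

/-! ## Nilpotent generation, fixed vectors and centralizer of `𝔰𝔬(V₀)` -/

section NilpotentGeneration

variable [FiniteDimensional 𝕜 V] {B : LinearMap.BilinForm 𝕜 V} {V₁ : Submodule 𝕜 V}

open SkewPlane

/-- **`𝔰𝔬(V₀)` is spanned by nilpotent (isotropic) wedges** — the Lie-algebra form of "the group
`H = SO⁺(a−2,b)` is generated by unipotents", the hypothesis under which Verbitsky applies Ratner's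
orbit-closure theorem [Verbitsky2017ErgodicErratum, §2.2, proof of the Theorem]. Setting: `B` a
non-degenerate symmetric bilinear form on a finite-dimensional `V` over a field of characteristic
`≠ 2`, `V₁` an anisotropic plane, `dim V ≥ 5`, `V₀ = V₁^⊥` containing a non-zero isotropic vector
(over `ℝ`: `V₀` indefinite, e.g. `V = ℝ^{3,19}`, `V₁` a positive plane, `V₀ ≅ ℝ^{1,19}`). Then a
`f ∈ End V` lies in `𝔰𝔬(V₀)` (is skew and kills `V₁`) iff it is a linear combination of wedges
`u ∧ w` with `u, w ∈ V₀`, `B(u,u) = B(u,w) = 0`; each such wedge `N` has `N³ = 0`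
(`SkewPlane.bwedge_pow_three_of_isotropic`), so `t ↦ exp(tN) = 1 + tN + t²N²/2` is a polynomial
unipotent one-parameter group. [folklore] [cite: Verbitsky2017ErgodicErratum, §2.2 (proof of the Theorem)] -/
theorem so_orthogonal_mem_iff_mem_span_isotropicWedge [NeZero (2 : 𝕜)] (hB : B.IsSymm)
    (hBn : B.Nondegenerate) (hV₁ : ∀ v ∈ V₁, B v v = 0 → v = 0) (h2 : finrank 𝕜 V₁ = 2)
    (h5 : 5 ≤ finrank 𝕜 V) (hiso : ∃ u ∈ B.orthogonal V₁, u ≠ 0 ∧ B u u = 0)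
    (f : Module.End 𝕜 V) :
    (f ∈ skewAdjointLieSubalgebra B ∧ ∀ v ∈ V₁, f v = 0) ↔
      f ∈ Submodule.span 𝕜 {g : Module.End 𝕜 V | ∃ u ∈ B.orthogonal V₁, ∃ w ∈ B.orthogonal V₁,
        B u u = 0 ∧ B u w = 0 ∧ g = ω⟦B; u, w⟧} := by
  constructor
  · rintro ⟨hf, hf1⟩
    exact mem_of_bwedge_mem hB hBn hV₁ _
      (bwedge_mem_of_isotropicWedge_mem hB hBn hV₁ h2 h5 hiso _ fun u hu w hw huu huw => by
        refine Submodule.subset_span ?_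
        exact ⟨u, hu, w, hw, huu, huw, rfl⟩) hf hf1
  · intro hf
    refine Submodule.span_induction
      (p := fun g _ => g ∈ skewAdjointLieSubalgebra B ∧ ∀ v ∈ V₁, g v = 0) ?_ ?_ ?_ ?_ hf
    · rintro g ⟨u, hu, w, hw, -, -, rfl⟩
      exact ⟨(mem_skewAdjointLieSubalgebra_iff B _).2 (bwedge_skew hB u w),
        fun e he => bwedge_apply_of_mem hB hu hw he⟩
    · exact ⟨(skewAdjointLieSubalgebra B).zero_mem, fun v _ => rfl⟩
    · rintro g g' - - ⟨hg, hg1⟩ ⟨hg', hg'1⟩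
      exact ⟨(skewAdjointLieSubalgebra B).add_mem hg hg', fun v hv => by
        rw [LinearMap.add_apply, hg1 v hv, hg'1 v hv, add_zero]⟩
    · rintro c g - ⟨hg, hg1⟩
      exact ⟨(skewAdjointLieSubalgebra B).smul_mem c hg, fun v hv => by
        rw [LinearMap.smul_apply, hg1 v hv, smul_zero]⟩

/-- **Anything containing the nilpotent generators contains `𝔰𝔬(V₀)`** (the form used downstream:
`N` = an annihilator, a centralizer, the tangent space of a closed subgroup, …). [folklore] -/
theorem so_orthogonal_le_of_isotropicWedge_mem [NeZero (2 : 𝕜)] (hB : B.IsSymm)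
    (hBn : B.Nondegenerate) (hV₁ : ∀ v ∈ V₁, B v v = 0 → v = 0) (h2 : finrank 𝕜 V₁ = 2)
    (h5 : 5 ≤ finrank 𝕜 V) (hiso : ∃ u ∈ B.orthogonal V₁, u ≠ 0 ∧ B u u = 0)
    (N : Submodule 𝕜 (Module.End 𝕜 V))
    (hN : ∀ u ∈ B.orthogonal V₁, ∀ w ∈ B.orthogonal V₁, B u u = 0 → B u w = 0 →
      (ω⟦B; u, w⟧ : Module.End 𝕜 V) ∈ N)
    {f : Module.End 𝕜 V} (hf : f ∈ skewAdjointLieSubalgebra B) (hf1 : ∀ v ∈ V₁, f v = 0) :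
    f ∈ N :=
  mem_of_bwedge_mem hB hBn hV₁ _ (bwedge_mem_of_isotropicWedge_mem hB hBn hV₁ h2 h5 hiso _ hN) hf hf1

/-- **Fixed vectors of `𝔰𝔬(V₀)`**: a vector killed by every nilpotent generator `u ∧ w`
(`u, w ∈ V₀` isotropic–orthogonal) — equivalently by all of `𝔰𝔬(V₀)`, equivalently fixed by the
unipotent one-parameter groups `exp(t u∧w)` — lies in `V₁`; and conversely. (Used with Borel's
density theorem to force rationality of `V₁` when the Ratner group is `SO(V₀)` itself.)
[folklore] -/
theorem forall_isotropicWedge_apply_eq_zero_iff [NeZero (2 : 𝕜)] (hB : B.IsSymm)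
    (hBn : B.Nondegenerate) (hV₁ : ∀ v ∈ V₁, B v v = 0 → v = 0) (h2 : finrank 𝕜 V₁ = 2)
    (h5 : 5 ≤ finrank 𝕜 V) (hiso : ∃ u ∈ B.orthogonal V₁, u ≠ 0 ∧ B u u = 0) (x : V) :
    (∀ u ∈ B.orthogonal V₁, ∀ w ∈ B.orthogonal V₁, B u u = 0 → B u w = 0 →
      (ω⟦B; u, w⟧ : Module.End 𝕜 V) x = 0) ↔ x ∈ V₁ := by
  constructor
  · intro hx
    refine mem_of_forall_bwedge_apply_eq_zero hB hBn hV₁ h2 h5 fun a ha b hb => ?_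
    have hmem := bwedge_mem_of_isotropicWedge_mem hB hBn hV₁ h2 h5 hiso
      (LinearMap.ker (LinearMap.applyₗ (R := 𝕜) (M₂ := V) x))
      (fun u hu w hw huu huw => LinearMap.mem_ker.2 (hx u hu w hw huu huw)) a ha b hb
    exact LinearMap.mem_ker.1 hmem
  · intro hx u hu w hw _ _
    exact bwedge_apply_of_mem hB hu hw hx

/-- **Centralizer of `𝔰𝔬(V₀)`**: an endomorphism of `V` commutes with every nilpotent generator
`u ∧ w` (`u, w ∈ V₀` isotropic–orthogonal) — equivalently with `𝔰𝔬(V₀)`, equivalently with the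
unipotent one-parameter groups `exp(t u∧w)` — iff it is a scalar on `V₀` and preserves `V₁`
(`dim V₀ ≥ 3`: the standard representation of `𝔰𝔬(V₀)` is absolutely irreducible). (Used with
Borel's density theorem to force rationality of `V₁` when the Ratner group is
`SO(V₀)·SO(V₁)`.) [folklore] -/
theorem forall_commute_isotropicWedge_iff [NeZero (2 : 𝕜)] (hB : B.IsSymm)
    (hBn : B.Nondegenerate) (hV₁ : ∀ v ∈ V₁, B v v = 0 → v = 0) (h2 : finrank 𝕜 V₁ = 2)
    (h5 : 5 ≤ finrank 𝕜 V) (hiso : ∃ u ∈ B.orthogonal V₁, u ≠ 0 ∧ B u u = 0)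
    (T : Module.End 𝕜 V) :
    (∀ u ∈ B.orthogonal V₁, ∀ w ∈ B.orthogonal V₁, B u u = 0 → B u w = 0 →
      T * (ω⟦B; u, w⟧ : Module.End 𝕜 V) = (ω⟦B; u, w⟧ : Module.End 𝕜 V) * T) ↔
    (∃ α : 𝕜, ∀ v ∈ B.orthogonal V₁, T v = α • v) ∧ (∀ e ∈ V₁, T e ∈ V₁) := by
  constructor
  · intro hT
    refine scalar_of_forall_commute_bwedge hB hBn hV₁ h2 h5 fun a ha b hb => ?_
    -- the centralizer of `T` is a subspace containing the nilpotent generators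
    let C : Submodule 𝕜 (Module.End 𝕜 V) :=
      LinearMap.ker (LinearMap.mulLeft 𝕜 T - LinearMap.mulRight 𝕜 T)
    have hC : ∀ S : Module.End 𝕜 V, S ∈ C ↔ T * S = S * T := fun S => by
      rw [LinearMap.mem_ker, LinearMap.sub_apply, LinearMap.mulLeft_apply,
        LinearMap.mulRight_apply, sub_eq_zero]
    exact (hC _).1 (bwedge_mem_of_isotropicWedge_mem hB hBn hV₁ h2 h5 hiso C
      (fun u hu w hw huu huw => (hC _).2 (hT u hu w hw huu huw)) a ha b hb)
  · rintro ⟨⟨α, hα⟩, hT1⟩ u hu w hw _ _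
    ext x
    obtain ⟨y, hy, z, hz, rfl⟩ := exists_add_eq hB hV₁ x
    have hTy := hT1 y hy
    rw [Module.End.mul_apply, Module.End.mul_apply, bwedge_apply, bwedge_apply, map_add, map_add,
      map_add, hα z hz, map_sub, map_smul, map_smul, hα u hu, hα w hw, map_add, map_add,
      B_eq_zero_of_mem_orthogonal_of_mem hB hy hw, B_eq_zero_of_mem_orthogonal_of_mem hB hy hu,
      B_eq_zero_of_mem_orthogonal_of_mem hB hTy hw, B_eq_zero_of_mem_orthogonal_of_mem hB hTy hu,
      map_smul, map_smul]
    simp only [smul_eq_mul, zero_add, smul_smul, mul_comm α]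

end NilpotentGeneration


end Literature.Dynamics.Homogeneous
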